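import Summits.AtomisticToContinuum.FouriersLaw.Theorems.LocalOhmBVLocalOhmStubSoftExtractionAux3

/-!
# The level-`k` bound of the WEAK soft extraction (helper for `stub_softExtractionWeak`)

Helper file for stub `stub_softExtractionWeak` (S2c') of the birth line of crux `LocalOhmBV.LocalOhm`
(item stmt-AtomisticToContinuum-12009). It re-derives the level bound of
`…StubSoftExtractionAux3` (`level_bound`, `eventually_level_bound`) when the window–energy
covariance bound (b3) `|Cov_{Gibbs_N}(F_k, H_N)| ≤ C ‖F_k‖_{L²(Gibbs_N)}` is weakened to the
PER-OBSERVABLE form (b3') `|Cov_{Gibbs_N}(F_k, H_N)| ≤ B` (a constant depending on the profile `g`,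
uniform in `N`, the anchor and the position of the box). For the normalised level functional
`Λ_k(F) = (ρ_k(F_k) - θ_k(x_k) · Cov_{Gibbs_N}(F_k, H_N)/T²) / g_k` (`F_k = F ∘ embed N x_k`,
`g_k = d_k/(N-1)`) and a box observable `F = g ∘ boxRestrictAt a n`: the interior estimate (A) at the
re-centred centre `x_k + a`, the re-centring bound `|θ_k(x_k + a) - θ_k(x_k)| ≤ WV_{x_k}(k)` and the
violation `k · WV_{x_k}(k) < |g_k|` give `|Λ_k(F)| ≤ 2|A(n)| ‖F_k‖_{L²(Gibbs_N)} + |B|/(k T²)`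
(`level_bound'`, arithmetic core `level_bound_arith'`): the cross term is now `O(1/k)` instead of
`O(‖F_k‖₂)`. Along a violating sequence, for every `ε > 0`, EVENTUALLY in `k`,
`|Λ_k(g ∘ boxRestrictAt a n)| ≤ 2|A(n)| · √(‖g ∘ box‖²_{L²(μ∞)} + ε) + ε` (`eventually_level_bound'`,
transport of the `L²`-norm by the thermodynamic limit (b4) for `g²` as in Aux3). Finally
`le_mul_sqrt_add_of_forall_pos` removes the `ε`'s (continuity of `ε ↦ A √(S + ε) + ε` at `0⁺`).
-/

set_option autoImplicit false

noncomputable section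

namespace Summit.AtomisticToContinuum.FouriersLaw.Theorems.LocalOhmBirth.SoftExtraction

open MeasureTheory Filter Topology
open scoped BigOperators
open Literature.MathematicalPhysics.KineticTheory.HeatConduction
open Summit.AtomisticToContinuum.FouriersLaw.Theorems.WindowLimit (embed)

/-! ### Real arithmetic -/

/-- Removing the `ε`'s: if `t ≤ A · √(S + ε) + ε` for every `ε > 0` then `t ≤ A · √S` (continuity of
`ε ↦ A √(S + ε) + ε` at `0⁺`). [folklore] -/
theorem le_mul_sqrt_add_of_forall_pos {t A S : ℝ}
    (h : ∀ ε : ℝ, 0 < ε → t ≤ A * Real.sqrt (S + ε) + ε) : t ≤ A * Real.sqrt S := by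
  have hc : Tendsto (fun ε : ℝ => A * Real.sqrt (S + ε) + ε) (𝓝[>] 0)
      (𝓝 (A * Real.sqrt (S + 0) + 0)) :=
    (((continuous_const.mul ((continuous_const.add continuous_id).sqrt)).add continuous_id).tendsto
      0).mono_left nhdsWithin_le_nhds
  rw [add_zero, add_zero] at hc
  exact ge_of_tendsto hc (eventually_nhdsWithin_of_forall fun ε hε => h ε hε)

/-- **Arithmetic of the weak level bound.** From `|ρ - θ'·V/T²| ≤ A s (|g| + Wₙ)` (the interior
estimate at the re-centred point), `Wₙ ≤ W_k`, `|θ' - θ₀| ≤ W_k` (re-centring), `k W_k < |g|` with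
`k ≥ 1` (the violation) and `|V| ≤ B` (per-observable covariance bound):
`|(ρ - θ₀ V/T²)/g| ≤ 2|A| s + |B|/(k T²)`. [folklore] -/
theorem level_bound_arith' {ρ θ' θ₀ V T A B g Wn Wk s : ℝ} {k : ℕ} (hT : 0 < T)
    (hA : |ρ - θ' * (V / T ^ 2)| ≤ A * s * (|g| + Wn))
    (hWn : Wn ≤ Wk) (hWn0 : 0 ≤ Wn) (hθ : |θ' - θ₀| ≤ Wk) (hviol : (k : ℝ) * Wk < |g|) (hk : 1 ≤ k)
    (hB : |V| ≤ B) (hs : 0 ≤ s) :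
    |(ρ - θ₀ * (V / T ^ 2)) / g| ≤ 2 * |A| * s + |B| / ((k : ℝ) * T ^ 2) := by
  have hT2 : 0 < T ^ 2 := by positivity
  have hWk0 : 0 ≤ Wk := hWn0.trans hWn
  have hk1 : (1 : ℝ) ≤ k := by exact_mod_cast hk
  have hk0 : (0 : ℝ) < k := by linarith
  have hWk : Wk < |g| := by nlinarith
  have hgpos : 0 < |g| := by linarith
  have hWk' : Wk ≤ |g| / k := by
    rw [le_div_iff₀ hk0]
    linarith [mul_comm (k : ℝ) Wk]
  have h1 : |ρ - θ' * (V / T ^ 2)| ≤ |A| * s * (2 * |g|) := by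
    calc |ρ - θ' * (V / T ^ 2)| ≤ A * s * (|g| + Wn) := hA
      _ ≤ |A| * s * (|g| + Wn) := by
          have : 0 ≤ s * (|g| + Wn) := by positivity
          nlinarith [le_abs_self A]
      _ ≤ |A| * s * (2 * |g|) := by
          have : 0 ≤ |A| * s := by positivity
          nlinarith
  have h2 : |(θ' - θ₀) * (V / T ^ 2)| ≤ |g| / k * (|B| / T ^ 2) := by
    rw [abs_mul, abs_div, abs_of_pos hT2]
    have hV : |V| ≤ |B| := hB.trans (le_abs_self B)
    exact mul_le_mul (hθ.trans hWk') (div_le_div_of_nonneg_right hV hT2.le) (by positivity)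
      (by positivity)
  have h3 : |ρ - θ₀ * (V / T ^ 2)| ≤ |g| * (2 * |A| * s + |B| / ((k : ℝ) * T ^ 2)) := by
    have : ρ - θ₀ * (V / T ^ 2) = (ρ - θ' * (V / T ^ 2)) + (θ' - θ₀) * (V / T ^ 2) := by ring
    rw [this]
    refine (abs_add_le _ _).trans ?_
    calc |ρ - θ' * (V / T ^ 2)| + |(θ' - θ₀) * (V / T ^ 2)|
        ≤ |A| * s * (2 * |g|) + |g| / k * (|B| / T ^ 2) := add_le_add h1 h2
      _ = |g| * (2 * |A| * s + |B| / ((k : ℝ) * T ^ 2)) := by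
          field_simp
  rw [abs_div, div_le_iff₀ hgpos]
  calc |ρ - θ₀ * (V / T ^ 2)| ≤ |g| * (2 * |A| * s + |B| / ((k : ℝ) * T ^ 2)) := h3
    _ = (2 * |A| * s + |B| / ((k : ℝ) * T ^ 2)) * |g| := by ring

/-! ### The weak level bound -/

/-- **Weak level bound.** At a single level (`N`, response coefficient `d`, profile `θ`, bulk centre
`x₀` at depth `k`), for a box profile `g` on `{a, …, a + n}`: the interior estimate (A) at radius
`n` (boundary width `b`, constant `A`) applied at the re-centred bulk centre `x₀ + a`, the identity
`μN T T = Gibbs_N`, the per-observable covariance bound `|Cov(F_k, H_N)| ≤ B` and the violating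
inequality give `|(ρ - θ(x₀) Cov(F_k, H_N)/T²)/(d/(N-1))| ≤ 2|A| ‖F_k‖_{L²(Gibbs_N)} + |B|/(k T²)`
for the response limit `ρ` of the transported observable `F_k = g ∘ boxRestrictAt a n ∘ embed N x₀`,
once `k ≥ n + b + |a| + 1`. [folklore] -/
theorem level_bound' (P : OscillatorChain) {N : ℕ} (μN : ℝ → ℝ → Measure (PhaseSpace N)) {T : ℝ}
    (hT : 0 < T) (d : ℝ) (θ : Fin N → ℝ) (x₀ k n b : ℕ) (A B : ℝ) (a : ℤ)
    (g : (Fin (n + 1) → ℝ × ℝ) → ℝ) (hg : Continuous g)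
    (hgb : ∃ (C₀ : ℝ) (m : ℕ), ∀ y, |g y| ≤ C₀ * (1 + ‖y‖) ^ m)
    (hA : ∀ x : ℕ, b + n ≤ x → x + n + b + 2 ≤ N →
      ∀ ψ : PhaseSpace N → ℝ, Continuous ψ →
        (∀ z z' : PhaseSpace N, (∀ i : Fin N, x ≤ i.val + n → i.val ≤ x + n + 1 →
          z.1 i = z'.1 i ∧ z.2 i = z'.2 i) → ψ z = ψ z') →
        (∃ (C₀ : ℝ) (m : ℕ), ∀ z, |ψ z| ≤ C₀ * (1 + ‖z‖) ^ m) →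
        ∀ ρ : ℝ, Tendsto (fun δ : ℝ => ((∫ z, ψ z ∂(μN (T + δ / 2) (T - δ / 2))) -
          ∫ z, ψ z ∂(μN T T)) / δ) (𝓝[≠] 0) (𝓝 ρ) →
        |ρ - (∑ i : Fin N, if i.val = x then θ i else 0) *
            (((∫ z, ψ z * P.hamiltonian N z ∂(μN T T)) -
              (∫ z, ψ z ∂(μN T T)) * (∫ z, P.hamiltonian N z ∂(μN T T))) / T ^ 2)| ≤
          A * Real.sqrt (∫ z, (ψ z) ^ 2 ∂(μN T T)) *
            (|d| / ((N : ℝ) - 1) + ∑ i : Fin N, ∑ j : Fin N,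
              (if j.val = i.val + 1 ∧ x ≤ i.val + n ∧ i.val ≤ x + n then |θ j - θ i| else 0)))
    (ha1 : μN T T = P.gibbsMeasure N T)
    (hb3 : |(∫ z, g (boxRestrictAt a n (embed N x₀ z)) * P.hamiltonian N z ∂(P.gibbsMeasure N T)) -
          (∫ z, g (boxRestrictAt a n (embed N x₀ z)) ∂(P.gibbsMeasure N T)) *
            (∫ z, P.hamiltonian N z ∂(P.gibbsMeasure N T))| ≤ B)
    {ρ : ℝ} (hρ : Tendsto (fun δ : ℝ =>
      ((∫ z, g (boxRestrictAt a n (embed N x₀ z)) ∂(μN (T + δ / 2) (T - δ / 2))) -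
        ∫ z, g (boxRestrictAt a n (embed N x₀ z)) ∂(μN T T)) / δ) (𝓝[≠] 0) (𝓝 ρ))
    (hk₁ : k ≤ x₀) (hk₂ : x₀ + k + 2 ≤ N)
    (hviol : (k : ℝ) * ∑ i : Fin N, ∑ j : Fin N,
        (if j.val = i.val + 1 ∧ x₀ ≤ i.val + k ∧ i.val ≤ x₀ + k then |θ j - θ i| else 0) <
      |d| / ((N : ℝ) - 1))
    (hK : n + b + a.natAbs + 1 ≤ k) :
    |(ρ - (∑ i : Fin N, if i.val = x₀ then θ i else 0) *
        (((∫ z, g (boxRestrictAt a n (embed N x₀ z)) * P.hamiltonian N z ∂(P.gibbsMeasure N T)) -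
          (∫ z, g (boxRestrictAt a n (embed N x₀ z)) ∂(P.gibbsMeasure N T)) *
            (∫ z, P.hamiltonian N z ∂(P.gibbsMeasure N T))) / T ^ 2)) / (d / ((N : ℝ) - 1))| ≤
      2 * |A| * Real.sqrt (∫ z, (g (boxRestrictAt a n (embed N x₀ z))) ^ 2 ∂(P.gibbsMeasure N T)) +
        |B| / ((k : ℝ) * T ^ 2) := by
  obtain ⟨C₀, m, hC₀⟩ := hgb
  -- the re-centred bulk centre `x' = x₀ + a`
  obtain ⟨x', hx'⟩ : ∃ x' : ℕ, (x' : ℤ) = x₀ + a := ⟨(x₀ + a).toNat, by omega⟩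
  have hx'1 : b + n ≤ x' := by omega
  have hx'2 : x' + n + b + 2 ≤ N := by omega
  -- the interior estimate at `x'` for the transported observable
  have hwin : ∀ z z' : PhaseSpace N, (∀ i : Fin N, x' ≤ i.val + n → i.val ≤ x' + n + 1 →
      z.1 i = z'.1 i ∧ z.2 i = z'.2 i) →
      g (boxRestrictAt a n (embed N x₀ z)) = g (boxRestrictAt a n (embed N x₀ z')) := by
    intro z z' h
    rw [boxRestrictAt_embed_eq_of_agree x' n (by omega) (by omega) z z' h]
  have hAx := hA x' hx'1 hx'2 (fun z => g (boxRestrictAt a n (embed N x₀ z)))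
    (continuous_comp_boxRestrictAt_embed a n hg) hwin
    ⟨C₀, m, fun z => polyBound_comp_boxRestrictAt_embed a n hC₀ z⟩ ρ hρ
  rw [ha1] at hAx
  -- `|d|/(N-1) = |d/(N-1)|`
  have hN1 : (0 : ℝ) < (N : ℝ) - 1 := by
    have : (2 : ℝ) ≤ N := by exact_mod_cast (by omega : 2 ≤ N)
    linarith
  have habs : |d| / ((N : ℝ) - 1) = |d / ((N : ℝ) - 1)| := by rw [abs_div, abs_of_pos hN1]
  rw [habs] at hAx hviol
  -- the pieces of the arithmetic core
  have hWn := windowVariation_mono θ (x := x₀) (x' := x') (n := n) (k := k) (by omega) (by omega)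
  have hθ := abs_centre_sub_le_windowVariation θ (x := x₀) (x' := x') (k := k) (by omega) (by omega)
    (by omega) (by omega)
  exact level_bound_arith' hT hAx hWn (windowVariation_nonneg θ x' n) hθ hviol (by omega) hb3
    (Real.sqrt_nonneg _)

/-! ### Eventual regularity bound along the violating sequence -/

/-- **Eventual weak regularity bound of the level functionals** along a violating sequence,
uniformly in the position of the box: with the per-observable covariance bound (b3') (constant `B`
for the profile `g`), for every `ε > 0`, eventually in `k`,
`|Λ_k(g ∘ boxRestrictAt a n)| ≤ 2|A| √(‖g ∘ box‖²_{L²(μ∞)} + ε) + ε`. [folklore] -/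
theorem eventually_level_bound' :
    ∀ (P : OscillatorChain) (μ : (N : ℕ) → ℝ → ℝ → Measure (PhaseSpace N)) {T : ℝ}, 0 < T →
    ∀ (n b : ℕ) (A : ℝ),
    (∀ (N : ℕ) (d : ℝ) (θ : Fin N → ℝ),
      Tendsto (fun δ : ℝ => P.totalCurrent (μ N (T + δ / 2) (T - δ / 2)) / δ) (𝓝[≠] 0) (𝓝 d) →
      (∀ i : Fin N, Tendsto (fun δ : ℝ => ((∫ x, (x.2 i) ^ 2 ∂(μ N (T + δ / 2) (T - δ / 2))) -
        ∫ x, (x.2 i) ^ 2 ∂(μ N T T)) / δ) (𝓝[≠] 0) (𝓝 (θ i))) →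
      ∀ x : ℕ, b + n ≤ x → x + n + b + 2 ≤ N →
      ∀ ψ : PhaseSpace N → ℝ, Continuous ψ →
        (∀ z z' : PhaseSpace N, (∀ i : Fin N, x ≤ i.val + n → i.val ≤ x + n + 1 →
          z.1 i = z'.1 i ∧ z.2 i = z'.2 i) → ψ z = ψ z') →
        (∃ (C₀ : ℝ) (m : ℕ), ∀ z, |ψ z| ≤ C₀ * (1 + ‖z‖) ^ m) →
        ∀ ρ : ℝ, Tendsto (fun δ : ℝ => ((∫ z, ψ z ∂(μ N (T + δ / 2) (T - δ / 2))) -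
          ∫ z, ψ z ∂(μ N T T)) / δ) (𝓝[≠] 0) (𝓝 ρ) →
        |ρ - (∑ i : Fin N, if i.val = x then θ i else 0) *
            (((∫ z, ψ z * P.hamiltonian N z ∂(μ N T T)) -
              (∫ z, ψ z ∂(μ N T T)) * (∫ z, P.hamiltonian N z ∂(μ N T T))) / T ^ 2)| ≤
          A * Real.sqrt (∫ z, (ψ z) ^ 2 ∂(μ N T T)) *
            (|d| / ((N : ℝ) - 1) + ∑ i : Fin N, ∑ j : Fin N,
              (if j.val = i.val + 1 ∧ x ≤ i.val + n ∧ i.val ≤ x + n then |θ j - θ i| else 0))) →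
    (∀ N : ℕ, 3 ≤ N → μ N T T = P.gibbsMeasure N T) →
    (∀ N : ℕ, 3 ≤ N → ∀ ψ : PhaseSpace N → ℝ, Continuous ψ →
        (∃ (C₀ : ℝ) (m : ℕ), ∀ z, |ψ z| ≤ C₀ * (1 + ‖z‖) ^ m) →
        ∃ ρ : ℝ, Tendsto (fun δ : ℝ => ((∫ z, ψ z ∂(μ N (T + δ / 2) (T - δ / 2))) -
          ∫ z, ψ z ∂(μ N T T)) / δ) (𝓝[≠] 0) (𝓝 ρ)) →
    ∀ {μinf : Measure ChainConfig},
    (∀ (n : ℕ) (g : (Fin (n + 1) → ℝ × ℝ) → ℝ), Continuous g →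
      (∃ (C₀ : ℝ) (m : ℕ), ∀ y, |g y| ≤ C₀ * (1 + ‖y‖) ^ m) →
      ∀ ε : ℝ, 0 < ε → ∃ L N₀ : ℕ, ∀ (N c : ℕ) (a : ℤ), N₀ ≤ N → (L : ℤ) ≤ a + c →
        a + c + n + L < N →
        |(∫ z, g (boxRestrictAt a n (embed N c z)) ∂(P.gibbsMeasure N T)) -
            ∫ σ, g (boxRestrictAt a n σ) ∂μinf| ≤ ε) →
    ∀ (Nk : ℕ → ℕ) (dk : ℕ → ℝ) (θk : (k : ℕ) → Fin (Nk k) → ℝ) (xk : ℕ → ℕ),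
    (∀ k : ℕ, Tendsto (fun δ : ℝ =>
        P.totalCurrent (μ (Nk k) (T + δ / 2) (T - δ / 2)) / δ) (𝓝[≠] 0) (𝓝 (dk k))) →
    (∀ (k : ℕ) (i : Fin (Nk k)), Tendsto (fun δ : ℝ =>
        ((∫ x, (x.2 i) ^ 2 ∂(μ (Nk k) (T + δ / 2) (T - δ / 2))) - ∫ x, (x.2 i) ^ 2 ∂(μ (Nk k) T T)) /
          δ) (𝓝[≠] 0) (𝓝 (θk k i))) →
    (∀ k : ℕ, k ≤ xk k) → (∀ k : ℕ, xk k + k + 2 ≤ Nk k) →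
    (∀ k : ℕ, (k : ℝ) * ∑ i : Fin (Nk k), ∑ j : Fin (Nk k),
        (if j.val = i.val + 1 ∧ xk k ≤ i.val + k ∧ i.val ≤ xk k + k then |θk k j - θk k i| else 0) <
      |dk k| / ((Nk k : ℝ) - 1)) →
    ∀ (a : ℤ) (g : (Fin (n + 1) → ℝ × ℝ) → ℝ), Continuous g →
    (∃ (C₀ : ℝ) (m : ℕ), ∀ y, |g y| ≤ C₀ * (1 + ‖y‖) ^ m) →
    ∀ B : ℝ, (∀ (N c : ℕ) (a : ℤ), 0 ≤ a + c → a + c + n < N →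
      |(∫ z, g (boxRestrictAt a n (embed N c z)) * P.hamiltonian N z ∂(P.gibbsMeasure N T)) -
          (∫ z, g (boxRestrictAt a n (embed N c z)) ∂(P.gibbsMeasure N T)) *
            (∫ z, P.hamiltonian N z ∂(P.gibbsMeasure N T))| ≤ B) →
    ∀ ε : ℝ, 0 < ε →
    ∀ᶠ k in atTop,
      |(limUnder (𝓝[≠] (0 : ℝ)) (fun δ : ℝ =>
            ((∫ z, g (boxRestrictAt a n (embed (Nk k) (xk k) z)) ∂(μ (Nk k) (T + δ / 2) (T - δ / 2))) -
              ∫ z, g (boxRestrictAt a n (embed (Nk k) (xk k) z)) ∂(μ (Nk k) T T)) / δ) -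
          (∑ i : Fin (Nk k), if i.val = xk k then θk k i else 0) *
            (((∫ z, g (boxRestrictAt a n (embed (Nk k) (xk k) z)) * P.hamiltonian (Nk k) z
                ∂(P.gibbsMeasure (Nk k) T)) -
              (∫ z, g (boxRestrictAt a n (embed (Nk k) (xk k) z)) ∂(P.gibbsMeasure (Nk k) T)) *
                (∫ z, P.hamiltonian (Nk k) z ∂(P.gibbsMeasure (Nk k) T))) / T ^ 2)) /
          (dk k / ((Nk k : ℝ) - 1))| ≤
        2 * |A| * Real.sqrt ((∫ σ, (g (boxRestrictAt a n σ)) ^ 2 ∂μinf) + ε) + ε := by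
  intro P μ T hT n b A hA ha1 ha2 μinf hb4 Nk dk θk xk hD hΘ hx₁ hx₂ hlt a g hg hgb B hB ε hε
  obtain ⟨C₀, m, hC₀⟩ := hgb
  -- the thermodynamic limit (b4) for `g²`
  have hg2 : Continuous fun y => (g y) ^ 2 := hg.pow 2
  have hg2b : ∃ (C₁ : ℝ) (m₁ : ℕ), ∀ y, |(g y) ^ 2| ≤ C₁ * (1 + ‖y‖) ^ m₁ := by
    refine ⟨C₀ ^ 2, 2 * m, fun y => ?_⟩
    rw [abs_pow]
    calc |g y| ^ 2 ≤ (C₀ * (1 + ‖y‖) ^ m) ^ 2 := pow_le_pow_left₀ (abs_nonneg _) (hC₀ y) 2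
      _ = C₀ ^ 2 * (1 + ‖y‖) ^ (2 * m) := by ring
  obtain ⟨L, N₀, hb4'⟩ := hb4 n (fun y => (g y) ^ 2) hg2 hg2b ε hε
  have hT2 : 0 < T ^ 2 := by positivity
  filter_upwards [eventually_ge_atTop (n + b + a.natAbs + N₀ + L + 3 + ⌈|B| / (ε * T ^ 2)⌉₊)]
    with k hk
  have hxk := hx₁ k
  have hNk := hx₂ k
  have hN3 : 3 ≤ Nk k := by omega
  -- the `1/k` term is below `ε`
  have hkB : |B| / (ε * T ^ 2) < k := Nat.lt_of_ceil_lt (by omega)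
  have hk0 : (0 : ℝ) < k := by
    have : (1 : ℝ) ≤ k := by exact_mod_cast (by omega : 1 ≤ k)
    linarith
  have hBε : |B| / ((k : ℝ) * T ^ 2) ≤ ε := by
    rw [div_le_iff₀ (by positivity)]
    rw [div_lt_iff₀ (by positivity)] at hkB
    nlinarith
  -- the response limit of the transported observable exists
  have hcont := continuous_comp_boxRestrictAt_embed (N := Nk k) (c := xk k) a n hg
  have hbd : ∃ (C₁ : ℝ) (m₁ : ℕ), ∀ z : PhaseSpace (Nk k),
      |g (boxRestrictAt a n (embed (Nk k) (xk k) z))| ≤ C₁ * (1 + ‖z‖) ^ m₁ :=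
    ⟨C₀, m, fun z => polyBound_comp_boxRestrictAt_embed a n hC₀ z⟩
  have hρ := tendsto_nhds_limUnder (ha2 (Nk k) hN3 _ hcont hbd)
  -- the single-level bound
  have hlev := level_bound' P (μ (Nk k)) hT (dk k) (θk k) (xk k) k n b A B a g hg ⟨C₀, m, hC₀⟩
    (hA (Nk k) (dk k) (θk k) (hD k) (hΘ k)) (ha1 (Nk k) hN3)
    (hB (Nk k) (xk k) a (by omega) (by omega)) hρ hxk hNk (hlt k) (by omega)
  refine hlev.trans (add_le_add (mul_le_mul_of_nonneg_left (Real.sqrt_le_sqrt ?_) (by positivity))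
    hBε)
  -- transport of the `L²`-norm by (b4)
  have h4 : |(∫ z, (g (boxRestrictAt a n (embed (Nk k) (xk k) z))) ^ 2 ∂(P.gibbsMeasure (Nk k) T)) -
      ∫ σ, (g (boxRestrictAt a n σ)) ^ 2 ∂μinf| ≤ ε :=
    hb4' (Nk k) (xk k) a (by omega) (by omega) (by omega)
  linarith [(abs_sub_le_iff.1 h4).1]

end Summit.AtomisticToContinuum.FouriersLaw.Theorems.LocalOhmBirth.SoftExtraction

end
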